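import Mathlib.Analysis.Fourier.Inversion
import Mathlib.Analysis.Fourier.FourierTransform
import Mathlib.Analysis.SpecialFunctions.Integrals.Basic
import Mathlib.Analysis.SpecialFunctions.Trigonometric.Bounds
import Mathlib.Analysis.Real.Pi.Bounds
import Mathlib.Analysis.SpecialFunctions.Log.Deriv
import Mathlib.Analysis.Complex.ExponentialBounds
import Mathlib.MeasureTheory.Integral.IntervalIntegral.FundThmCalculus
import Mathlib.MeasureTheory.Measure.Haar.NormedSpace
import HarnessLib

/-!
# Friedlander–Iwaniec, *The polynomial `X² + Y⁴` captures its primes*, Lemma 26.1 (Duke–Friedlander–Iwaniec): separation of variables constrained by `k ≤ x`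

Family `parity`, statement parity.S17. Source: J. Friedlander, H. Iwaniec, Ann. of Math. (2) 148 (1998),
945–1040 [FriedlanderIwaniecAnnals1998], §26, Lemma 26.1 (arXiv math/9811185, pp. 84–85), quoted from
W. Duke, J. Friedlander, H. Iwaniec, *Bilinear forms with Kloosterman fractions*, Invent. Math. 128 (1997),
Lemma 9: "For `x ≥ 1` there exists a function `h(t)` such that `∫ |h(t)| dt < log 6x` and for every positive
integer `k`, `∫ h(t) k^{it} dt = 1` if `k ≤ x`, `0` otherwise." It is "useful for separating integral variables
`m, n` constrained by an inequality `mn ≤ x`" (used in §25 for `g(cℓ)` and in §26 for `S₃`).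

Everything here is PROVED; the construction: `h` is the Fourier transform of the trapezoid `H` with nodes
`-2, 0, L, L + δ`, `L = log ⌊x⌋`, `δ = log(1 + 1/⌊x⌋)`, so that `H(log k) = [k ≤ x]` for positive integers `k`
(Fourier inversion, Mathlib's `Continuous.fourierInv_fourier_eq`), and `∫ |𝓕 H| ≤ (3/π) log x + O(1)` from the
explicit formula `𝓕 H(w) = (e^{-2c} - 1)/(2c²) + (e^{c(L+δ)} - e^{cL})/(δ c²)`, `c = -2πiw` (the wide left ramp
is what makes the constant `3/π < 1`).

## References

* J. Friedlander, H. Iwaniec, Ann. of Math. (2) 148 (1998), 945–1040, Lemma 26.1. [FriedlanderIwaniecAnnals1998]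
* W. Duke, J. Friedlander, H. Iwaniec, Invent. Math. 128 (1997), 23–43, Lemma 9 (the source's [DFI]).
-/

noncomputable section

open Real Complex MeasureTheory Set intervalIntegral
open scoped FourierTransform

namespace Literature.NumberTheory.Sieve.FriedlanderIwaniecPrimes

/-! ### The trapezoid -/

/-- The trapezoid `H` with nodes `-2, 0, L, L + δ`: `0`, then linear up to `1` on `[-2, 0]`, `1` on `[0, L]`,
linear down to `0` on `[L, L+δ]`, then `0`. [cite: FriedlanderIwaniecAnnals1998, Lemma 26.1 (construction of DFI Lemma 9)] -/
def trapz (L δ y : ℝ) : ℝ := max 0 (min 1 (min ((y + 2) / 2) ((L + δ - y) / δ)))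

variable {L δ : ℝ}

/-- `H` is continuous. [folklore] -/
theorem continuous_trapz (L δ : ℝ) : Continuous (trapz L δ) := by
  unfold trapz; fun_prop

/-- `0 ≤ H ≤ 1`. [folklore] -/
theorem trapz_nonneg (L δ y : ℝ) : 0 ≤ trapz L δ y := le_max_left _ _

/-- `H ≤ 1`. [folklore] -/
theorem trapz_le_one (L δ y : ℝ) : trapz L δ y ≤ 1 :=
  max_le zero_le_one (min_le_left _ _)

/-- `H = 0` left of `-2`. [folklore] -/
theorem trapz_of_le_neg_two {y : ℝ} (hy : y ≤ -2) : trapz L δ y = 0 := by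
  unfold trapz
  refine max_eq_left ?_
  have h1 : (y + 2) / 2 ≤ 0 := by linarith
  calc min 1 (min ((y + 2) / 2) ((L + δ - y) / δ)) ≤ min ((y + 2) / 2) ((L + δ - y) / δ) := min_le_right _ _
    _ ≤ (y + 2) / 2 := min_le_left _ _
    _ ≤ 0 := h1

/-- `H = 0` right of `L + δ`. [folklore] -/
theorem trapz_of_ge (hδ : 0 < δ) {y : ℝ} (hy : L + δ ≤ y) : trapz L δ y = 0 := by
  unfold trapz
  refine max_eq_left ?_
  have h1 : (L + δ - y) / δ ≤ 0 := div_nonpos_of_nonpos_of_nonneg (by linarith) hδ.le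
  calc min 1 (min ((y + 2) / 2) ((L + δ - y) / δ)) ≤ min ((y + 2) / 2) ((L + δ - y) / δ) := min_le_right _ _
    _ ≤ (L + δ - y) / δ := min_le_right _ _
    _ ≤ 0 := h1

/-- `H` on the left ramp `[-2, 0]`. [folklore] -/
theorem trapz_of_mem_left (hδ : 0 < δ) (hL : 0 ≤ L) {y : ℝ} (hy : y ∈ Icc (-2 : ℝ) 0) :
    trapz L δ y = (y + 2) / 2 := by
  obtain ⟨h1, h2⟩ := hy
  unfold trapz
  have h3 : (y + 2) / 2 ≤ 1 := by linarith
  have h4 : (y + 2) / 2 ≤ (L + δ - y) / δ := by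
    rw [div_le_div_iff₀ (by norm_num : (0:ℝ) < 2) hδ]; nlinarith
  rw [min_eq_left h4, min_eq_right h3, max_eq_right (by linarith)]

/-- `H = 1` on the plateau `[0, L]`. [folklore] -/
theorem trapz_of_mem_mid (hδ : 0 < δ) {y : ℝ} (hy : y ∈ Icc 0 L) : trapz L δ y = 1 := by
  obtain ⟨h1, h2⟩ := hy
  unfold trapz
  have h3 : 1 ≤ (y + 2) / 2 := by linarith
  have h4 : 1 ≤ (L + δ - y) / δ := by rw [le_div_iff₀ hδ]; linarith
  rw [min_eq_left (le_min h3 h4), max_eq_right zero_le_one]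

/-- `H` on the right ramp `[L, L + δ]`. [folklore] -/
theorem trapz_of_mem_right (hδ : 0 < δ) (hL : 0 ≤ L) {y : ℝ} (hy : y ∈ Icc L (L + δ)) :
    trapz L δ y = (L + δ - y) / δ := by
  obtain ⟨h1, h2⟩ := hy
  unfold trapz
  have h3 : (L + δ - y) / δ ≤ 1 := by rw [div_le_iff₀ hδ]; linarith
  have h4 : (L + δ - y) / δ ≤ (y + 2) / 2 := by
    rw [div_le_div_iff₀ hδ (by norm_num : (0:ℝ) < 2)]; nlinarith
  have h5 : 0 ≤ (L + δ - y) / δ := div_nonneg (by linarith) hδ.le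
  rw [min_eq_right h4, min_eq_right h3, max_eq_right h5]

/-- The support of `H` is in `[-2, L + δ]`. [folklore] -/
theorem trapz_eq_zero_of_not_mem (hδ : 0 < δ) {y : ℝ} (hy : y ∉ Icc (-2 : ℝ) (L + δ)) : trapz L δ y = 0 := by
  rw [mem_Icc, not_and_or, not_le, not_le] at hy
  rcases hy with h | h
  · exact trapz_of_le_neg_two h.le
  · exact trapz_of_ge hδ h.le

/-- The complex-valued trapezoid. [folklore] -/
def trapzC (L δ : ℝ) : ℝ → ℂ := fun y => (trapz L δ y : ℂ)

/-- `H` (complex-valued) is continuous. [folklore] -/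
theorem continuous_trapzC (L δ : ℝ) : Continuous (trapzC L δ) :=
  continuous_ofReal.comp (continuous_trapz L δ)

/-- `‖H‖ ≤ 1`. [folklore] -/
theorem norm_trapzC_le (L δ y : ℝ) : ‖trapzC L δ y‖ ≤ 1 := by
  rw [trapzC, Complex.norm_real, Real.norm_eq_abs, abs_of_nonneg (trapz_nonneg L δ y)]
  exact trapz_le_one L δ y

/-- `H` is integrable (continuous with compact support). [folklore] -/
theorem integrable_trapzC (hδ : 0 < δ) (L : ℝ) : Integrable (trapzC L δ) := by
  refine (continuous_trapzC L δ).integrable_of_hasCompactSupport ?_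
  refine HasCompactSupport.of_support_subset_isCompact (isCompact_Icc (a := (-2 : ℝ)) (b := L + δ)) ?_
  intro y hy
  by_contra h
  exact hy (by rw [trapzC, trapz_eq_zero_of_not_mem hδ h, Complex.ofReal_zero])

/-! ### The Fourier transform of the trapezoid -/

/-- Antiderivative for the left ramp: `d/dv [((v+2)/(2c) - 1/(2c²)) e^{cv}] = ((v+2)/2) e^{cv}`. [folklore] -/
theorem hasDerivAt_leftRamp {c : ℂ} (hc : c ≠ 0) (v : ℝ) :
    HasDerivAt (fun u : ℝ => (((u : ℂ) + 2) / (2 * c) - 1 / (2 * c ^ 2)) * cexp (c * u))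
      ((((v : ℂ) + 2) / 2) * cexp (c * v)) v := by
  have h1 : HasDerivAt (fun u : ℝ => ((u : ℂ) + 2) / (2 * c) - 1 / (2 * c ^ 2)) (1 / (2 * c)) v := by
    have := ((hasDerivAt_id (v : ℂ)).add_const (2 : ℂ)).div_const (2 * c) |>.sub_const (1 / (2 * c ^ 2))
    simpa using this.comp_ofReal
  have h2 : HasDerivAt (fun u : ℝ => cexp (c * u)) (c * cexp (c * v)) v := by
    have := ((hasDerivAt_id (v : ℂ)).const_mul c).cexp
    simpa [mul_comm] using this.comp_ofReal
  have h := h1.mul h2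
  simp only [Pi.mul_def] at h
  exact h.congr_deriv (by field_simp; ring)

/-- Antiderivative for the right ramp: `d/dv [((L+δ-v)/(δc) + 1/(δc²)) e^{cv}] = ((L+δ-v)/δ) e^{cv}`. [folklore] -/
theorem hasDerivAt_rightRamp {c : ℂ} (hc : c ≠ 0) (hδ : δ ≠ 0) (L : ℝ) (v : ℝ) :
    HasDerivAt (fun u : ℝ => (((L : ℂ) + δ - u) / (δ * c) + 1 / (δ * c ^ 2)) * cexp (c * u))
      ((((L : ℂ) + δ - v) / δ) * cexp (c * v)) v := by
  have hδ' : (δ : ℂ) ≠ 0 := Complex.ofReal_ne_zero.mpr hδ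
  have h1 : HasDerivAt (fun u : ℝ => ((L : ℂ) + δ - u) / (δ * c) + 1 / (δ * c ^ 2)) (-1 / (δ * c)) v := by
    have := (((hasDerivAt_id (v : ℂ)).const_sub ((L : ℂ) + δ)).div_const (δ * c)).add_const (1 / (δ * c ^ 2))
    simpa [neg_div] using this.comp_ofReal
  have h2 : HasDerivAt (fun u : ℝ => cexp (c * u)) (c * cexp (c * v)) v := by
    have := ((hasDerivAt_id (v : ℂ)).const_mul c).cexp
    simpa [mul_comm] using this.comp_ofReal
  have h := h1.mul h2
  simp only [Pi.mul_def] at h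
  exact h.congr_deriv (by field_simp; ring)

/-- Antiderivative for the plateau: `d/dv [e^{cv}/c] = e^{cv}`. [folklore] -/
theorem hasDerivAt_plateau {c : ℂ} (hc : c ≠ 0) (v : ℝ) :
    HasDerivAt (fun u : ℝ => cexp (c * u) / c) (cexp (c * v)) v := by
  have h2 : HasDerivAt (fun u : ℝ => cexp (c * u)) (c * cexp (c * v)) v := by
    have := ((hasDerivAt_id (v : ℂ)).const_mul c).cexp
    simpa [mul_comm] using this.comp_ofReal
  exact (h2.div_const c).congr_deriv (by field_simp)

/-- **The Fourier transform of the trapezoid**: for `w ≠ 0`, with `c = -2πiw`,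
`𝓕 H(w) = ((e^{-2c} - 1)/2 + (e^{c(L+δ)} - e^{cL})/δ) / c²`. [folklore] -/
theorem fourier_trapzC (hδ : 0 < δ) (hL : 0 ≤ L) {w : ℝ} (hw : w ≠ 0) :
    𝓕 (trapzC L δ) w =
      ((cexp (-2 * (-2 * π * I * w)) - 1) / 2 +
        (cexp ((-2 * π * I * w) * (L + δ)) - cexp ((-2 * π * I * w) * L)) / δ) / (-2 * π * I * w) ^ 2 := by
  set c : ℂ := -2 * π * I * w with hc
  have hc0 : c ≠ 0 := by
    rw [hc]; simp [pi_ne_zero, hw, I_ne_zero]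
  have hδ0 : (δ : ℂ) ≠ 0 := Complex.ofReal_ne_zero.mpr hδ.ne'
  -- the integrand
  have hint : 𝓕 (trapzC L δ) w = ∫ v : ℝ, cexp (c * v) * trapzC L δ v := by
    rw [Real.fourier_real_eq_integral_exp_smul]
    refine integral_congr_ae (Filter.Eventually.of_forall fun v => ?_)
    simp only [smul_eq_mul, hc]
    congr 1
    push_cast
    ring_nf
  rw [hint]
  -- restrict to the support `[-2, L + δ]` and pass to an interval integral
  have hsupp : ∫ v : ℝ, cexp (c * v) * trapzC L δ v = ∫ v in (-2 : ℝ)..(L + δ), cexp (c * v) * trapzC L δ v := by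
    rw [intervalIntegral.integral_of_le (by linarith), ← integral_Icc_eq_integral_Ioc,
      setIntegral_eq_integral_of_forall_compl_eq_zero]
    intro v hv
    rw [trapzC, trapz_eq_zero_of_not_mem hδ hv, Complex.ofReal_zero, mul_zero]
  rw [hsupp]
  have hii : ∀ a b : ℝ, IntervalIntegrable (fun v : ℝ => cexp (c * v) * trapzC L δ v) volume a b :=
    fun a b => ((by fun_prop : Continuous fun v : ℝ => cexp (c * v)).mul (continuous_trapzC L δ)).intervalIntegrable a b
  rw [← integral_add_adjacent_intervals (hii (-2) 0) (hii 0 (L + δ)),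
    ← integral_add_adjacent_intervals (hii 0 L) (hii L (L + δ))]
  -- the three pieces
  have I1 : ∫ v in (-2 : ℝ)..0, cexp (c * v) * trapzC L δ v = 1 / c - 1 / (2 * c ^ 2) + cexp (-2 * c) / (2 * c ^ 2) := by
    have heq : EqOn (fun v : ℝ => cexp (c * v) * trapzC L δ v) (fun v : ℝ => (((v : ℂ) + 2) / 2) * cexp (c * v))
        (uIcc (-2 : ℝ) 0) := by
      intro v hv
      rw [uIcc_of_le (by norm_num)] at hv
      simp only [trapzC, trapz_of_mem_left hδ hL hv]
      push_cast; ring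
    rw [integral_congr heq, integral_eq_sub_of_hasDerivAt (fun v _ => hasDerivAt_leftRamp hc0 v)]
    · simp only [Complex.ofReal_zero, Complex.ofReal_neg, Complex.ofReal_ofNat, mul_zero, Complex.exp_zero]
      field_simp
      ring
    · exact ((by fun_prop : Continuous fun v : ℝ => (((v : ℂ) + 2) / 2) * cexp (c * v))).intervalIntegrable _ _
  have I2 : ∫ v in (0 : ℝ)..L, cexp (c * v) * trapzC L δ v = cexp (c * L) / c - 1 / c := by
    have heq : EqOn (fun v : ℝ => cexp (c * v) * trapzC L δ v) (fun v : ℝ => cexp (c * v)) (uIcc (0 : ℝ) L) := by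
      intro v hv
      rw [uIcc_of_le hL] at hv
      simp only [trapzC, trapz_of_mem_mid hδ hv]
      push_cast; ring
    rw [integral_congr heq, integral_eq_sub_of_hasDerivAt (fun v _ => hasDerivAt_plateau hc0 v)]
    · simp only [Complex.ofReal_zero, mul_zero, Complex.exp_zero]
    · exact ((by fun_prop : Continuous fun v : ℝ => cexp (c * v))).intervalIntegrable _ _
  have I3 : ∫ v in L..(L + δ), cexp (c * v) * trapzC L δ v =
      cexp (c * (L + δ)) / (δ * c ^ 2) - (cexp (c * L) / c + cexp (c * L) / (δ * c ^ 2)) := by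
    have heq : EqOn (fun v : ℝ => cexp (c * v) * trapzC L δ v)
        (fun v : ℝ => (((L : ℂ) + δ - v) / δ) * cexp (c * v)) (uIcc L (L + δ)) := by
      intro v hv
      rw [uIcc_of_le (by linarith)] at hv
      simp only [trapzC, trapz_of_mem_right hδ hL hv]
      push_cast; ring
    rw [integral_congr heq, integral_eq_sub_of_hasDerivAt (fun v _ => hasDerivAt_rightRamp hc0 hδ.ne' L v)]
    · push_cast
      field_simp
      ring
    · exact ((by fun_prop : Continuous fun v : ℝ => (((L : ℂ) + δ - v) / δ) * cexp (c * v))).intervalIntegrable _ _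
  rw [I1, I2, I3]
  field_simp
  ring

/-! ### Pointwise bounds for `𝓕 H` -/

/-- `‖e^{iθ} - 1‖ ≤ min(2, |θ|)`. [folklore] -/
theorem norm_cexp_I_mul_sub_one_le (θ : ℝ) : ‖cexp (I * θ) - 1‖ ≤ min 2 |θ| := by
  refine le_min ?_ ?_
  · calc ‖cexp (I * θ) - 1‖ ≤ ‖cexp (I * θ)‖ + ‖(1 : ℂ)‖ := norm_sub_le _ _
      _ = 2 := by rw [mul_comm, Complex.norm_exp_ofReal_mul_I, norm_one]; norm_num
  · simpa using (Real.norm_exp_I_mul_ofReal_sub_one_le (x := θ))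

/-- `‖e^{a} (e^{iθ} - 1)‖ ≤ min(2,|θ|)` for `a` purely imaginary: the form in which the two numerators of
`fourier_trapzC` appear. [folklore] -/
theorem norm_cexp_sub_cexp_le (w a b : ℝ) :
    ‖cexp (-2 * π * I * w * a) - cexp (-2 * π * I * w * b)‖ ≤ min 2 (2 * π * |w| * |a - b|) := by
  have h : cexp (-2 * π * I * w * a) - cexp (-2 * π * I * w * b) =
      cexp (-2 * π * I * w * b) * (cexp (I * ↑(-2 * π * w * (a - b))) - 1) := by
    rw [mul_sub, mul_one, ← Complex.exp_add]
    congr 1; push_cast; ring_nf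
  rw [h, norm_mul, show -2 * (π : ℂ) * I * w * b = ↑(-2 * π * w * b) * I by push_cast; ring,
    Complex.norm_exp_ofReal_mul_I, one_mul]
  refine (norm_cexp_I_mul_sub_one_le _).trans (le_of_eq ?_)
  congr 1
  rw [abs_mul, abs_mul, abs_mul, abs_neg, abs_two, abs_of_pos pi_pos]

/-- **Decay of `𝓕 H`**: for `w ≠ 0`,
`‖𝓕 H(w)‖ ≤ (min(1, 2π|w|) + min(2/δ, 2π|w|)) / (4π²w²)`. [folklore] -/
theorem norm_fourier_trapzC_le (hδ : 0 < δ) (hL : 0 ≤ L) {w : ℝ} (hw : w ≠ 0) :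
    ‖𝓕 (trapzC L δ) w‖ ≤ (min 1 (2 * π * |w|) + min (2 / δ) (2 * π * |w|)) / (4 * π ^ 2 * w ^ 2) := by
  rw [fourier_trapzC hδ hL hw, norm_div]
  have hden : ‖(-2 * (π : ℂ) * I * w) ^ 2‖ = 4 * π ^ 2 * w ^ 2 := by
    rw [norm_pow, norm_mul, norm_mul, norm_mul, norm_neg, Complex.norm_ofNat, Complex.norm_real,
      Complex.norm_I, Complex.norm_real, Real.norm_eq_abs, Real.norm_eq_abs, abs_of_pos pi_pos, mul_one]
    rw [mul_pow, mul_pow, sq_abs]; ring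
  rw [hden]
  refine div_le_div_of_nonneg_right ?_ (by positivity)
  refine (norm_add_le _ _).trans (add_le_add ?_ ?_)
  · rw [norm_div, Complex.norm_ofNat]
    have h := norm_cexp_sub_cexp_le w (-2) 0
    rw [show -2 * (π : ℂ) * I * w * (-2 : ℝ) = -2 * (-2 * π * I * w) by push_cast; ring,
      show -2 * (π : ℂ) * I * w * (0 : ℝ) = 0 by push_cast; ring, Complex.exp_zero] at h
    rw [div_le_iff₀ (by norm_num : (0:ℝ) < 2)]
    refine h.trans (le_of_eq ?_)
    rw [show |(-2 : ℝ) - 0| = 2 by norm_num, min_mul_of_nonneg _ _ (by norm_num : (0:ℝ) ≤ 2)]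
    congr 1; ring
  · rw [norm_div, Complex.norm_real, Real.norm_eq_abs, abs_of_pos hδ]
    have h := norm_cexp_sub_cexp_le w (L + δ) L
    rw [show -2 * (π : ℂ) * I * w * ((L + δ : ℝ) : ℂ) = -2 * π * I * w * (L + δ) by push_cast; ring,
      show -2 * (π : ℂ) * I * w * (L : ℝ) = -2 * π * I * w * L by ring] at h
    rw [div_le_iff₀ hδ]
    refine h.trans ?_
    rw [min_mul_of_nonneg _ _ hδ.le, show L + δ - L = δ by ring, abs_of_pos hδ]
    refine min_le_min (le_of_eq (by field_simp)) (le_of_eq (by ring))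

/-- The area of the trapezoid: `∫ H = 1 + L + δ/2`. [folklore] -/
theorem integral_trapz (hδ : 0 < δ) (hL : 0 ≤ L) : ∫ y, trapz L δ y = 1 + L + δ / 2 := by
  have hsupp : ∫ y, trapz L δ y = ∫ y in (-2 : ℝ)..(L + δ), trapz L δ y := by
    rw [intervalIntegral.integral_of_le (by linarith), ← integral_Icc_eq_integral_Ioc,
      setIntegral_eq_integral_of_forall_compl_eq_zero]
    intro v hv
    exact trapz_eq_zero_of_not_mem hδ hv
  have hii : ∀ a b : ℝ, IntervalIntegrable (trapz L δ) volume a b := fun a b => (continuous_trapz L δ).intervalIntegrable a b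
  rw [hsupp, ← integral_add_adjacent_intervals (hii (-2) 0) (hii 0 (L + δ)),
    ← integral_add_adjacent_intervals (hii 0 L) (hii L (L + δ))]
  have I1 : ∫ y in (-2 : ℝ)..0, trapz L δ y = 1 := by
    rw [integral_congr (g := fun y : ℝ => (y + 2) / 2) (fun y hy => trapz_of_mem_left hδ hL (by rwa [uIcc_of_le (by norm_num)] at hy))]
    rw [integral_eq_sub_of_hasDerivAt (f := fun y : ℝ => (y + 2) ^ 2 / 4) (fun y _ => ?_)]
    · norm_num
    · exact (by fun_prop : Continuous fun y : ℝ => (y + 2) / 2).intervalIntegrable _ _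
    · have := ((hasDerivAt_id y).add_const (2:ℝ)).pow 2 |>.div_const 4
      exact this.congr_deriv (by simp; ring)
  have I2 : ∫ y in (0 : ℝ)..L, trapz L δ y = L := by
    rw [integral_congr (g := fun _ : ℝ => (1 : ℝ)) (fun y hy => trapz_of_mem_mid hδ (by rwa [uIcc_of_le hL] at hy))]
    simp
  have I3 : ∫ y in L..(L + δ), trapz L δ y = δ / 2 := by
    rw [integral_congr (g := fun y : ℝ => (L + δ - y) / δ) (fun y hy => trapz_of_mem_right hδ hL (by rwa [uIcc_of_le (by linarith)] at hy))]
    rw [integral_eq_sub_of_hasDerivAt (f := fun y : ℝ => -(L + δ - y) ^ 2 / (2 * δ)) (fun y _ => ?_)]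
    · field_simp; ring
    · exact (by fun_prop : Continuous fun y : ℝ => (L + δ - y) / δ).intervalIntegrable _ _
    · have := (((hasDerivAt_id y).const_sub (L + δ)).pow 2).neg.div_const (2 * δ)
      exact this.congr_deriv (by simp only [id_eq]; field_simp; ring)
  rw [I1, I2, I3]; ring

/-- The trivial bound `‖𝓕 H(w)‖ ≤ ∫ H = 1 + L + δ/2`. [folklore] -/
theorem norm_fourier_trapzC_le_area (hδ : 0 < δ) (hL : 0 ≤ L) (w : ℝ) :
    ‖𝓕 (trapzC L δ) w‖ ≤ 1 + L + δ / 2 := by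
  calc ‖𝓕 (trapzC L δ) w‖ ≤ ∫ v, ‖trapzC L δ v‖ := VectorFourier.norm_fourierIntegral_le_integral_norm _ _ _ _ _
    _ = ∫ v, trapz L δ v := by
        refine integral_congr_ae (Filter.Eventually.of_forall fun v => ?_)
        simp only [trapzC, Complex.norm_real, Real.norm_eq_abs, abs_of_nonneg (trapz_nonneg L δ v)]
    _ = 1 + L + δ / 2 := integral_trapz hδ hL

/-- `𝓕 H` is continuous. [folklore] -/
theorem continuous_fourier_trapzC (hδ : 0 < δ) (L : ℝ) : Continuous (𝓕 (trapzC L δ)) :=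
  VectorFourier.fourierIntegral_continuous Real.continuous_fourierChar (by fun_prop) (integrable_trapzC hδ L)

/-- The four working bounds for `‖𝓕 H(w)‖`, `w ≠ 0`: `≤ 1/(π|w|)`, `≤ 1/(4π²w²) + 1/(2π|w|)`,
`≤ (1 + 2/δ)/(4π²w²)`. [folklore] -/
theorem norm_fourier_trapzC_le_three (hδ : 0 < δ) (hL : 0 ≤ L) {w : ℝ} (hw : w ≠ 0) :
    ‖𝓕 (trapzC L δ) w‖ ≤ 1 / (π * |w|) ∧
      ‖𝓕 (trapzC L δ) w‖ ≤ 1 / (4 * π ^ 2 * w ^ 2) + 1 / (2 * π * |w|) ∧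
      ‖𝓕 (trapzC L δ) w‖ ≤ (1 + 2 / δ) / (4 * π ^ 2 * w ^ 2) := by
  have h := norm_fourier_trapzC_le hδ hL hw
  have hw' : 0 < |w| := abs_pos.mpr hw
  have hπ := pi_pos
  have hD : 0 < 4 * π ^ 2 * w ^ 2 := by positivity
  have hw2 : w ^ 2 = |w| ^ 2 := (sq_abs w).symm
  refine ⟨h.trans ?_, h.trans ?_, h.trans ?_⟩
  · calc (min 1 (2 * π * |w|) + min (2 / δ) (2 * π * |w|)) / (4 * π ^ 2 * w ^ 2)
          ≤ (2 * π * |w| + 2 * π * |w|) / (4 * π ^ 2 * w ^ 2) :=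
            div_le_div_of_nonneg_right (add_le_add (min_le_right _ _) (min_le_right _ _)) hD.le
      _ = 1 / (π * |w|) := by rw [hw2]; field_simp; ring
  · calc (min 1 (2 * π * |w|) + min (2 / δ) (2 * π * |w|)) / (4 * π ^ 2 * w ^ 2)
          ≤ (1 + 2 * π * |w|) / (4 * π ^ 2 * w ^ 2) :=
            div_le_div_of_nonneg_right (add_le_add (min_le_left _ _) (min_le_right _ _)) hD.le
      _ = 1 / (4 * π ^ 2 * w ^ 2) + 1 / (2 * π * |w|) := by rw [hw2]; field_simp; ring
  · exact div_le_div_of_nonneg_right (add_le_add (min_le_left _ _) (min_le_left _ _)) hD.le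

/-- `𝓕 H` is integrable (it is `O(1/(1 + w²))`). [folklore] -/
theorem integrable_fourier_trapzC (hδ : 0 < δ) (hL : 0 ≤ L) : Integrable (𝓕 (trapzC L δ)) := by
  set T := 1 + L + δ / 2 with hT
  set K := max (2 * T) ((1 + 2 / δ) / (2 * π ^ 2)) with hK
  refine Integrable.mono' ((integrable_inv_one_add_sq).const_mul K)
    (continuous_fourier_trapzC hδ L).aestronglyMeasurable (Filter.Eventually.of_forall fun w => ?_)
  have hπ := pi_pos
  rcases le_or_gt |w| 1 with hw1 | hw1
  · calc ‖𝓕 (trapzC L δ) w‖ ≤ T := norm_fourier_trapzC_le_area hδ hL w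
      _ ≤ 2 * T * (1 + w ^ 2)⁻¹ := by
          rw [← div_eq_mul_inv, le_div_iff₀ (by positivity)]
          have : w ^ 2 ≤ 1 := by rw [← sq_abs]; exact pow_le_one₀ (abs_nonneg w) hw1
          have hT0 : 0 ≤ T := by rw [hT]; linarith
          nlinarith
      _ ≤ K * (1 + w ^ 2)⁻¹ := mul_le_mul_of_nonneg_right (le_max_left _ _) (by positivity)
  · have hw0 : w ≠ 0 := fun h => by rw [h, abs_zero] at hw1; linarith
    calc ‖𝓕 (trapzC L δ) w‖ ≤ (1 + 2 / δ) / (4 * π ^ 2 * w ^ 2) := (norm_fourier_trapzC_le_three hδ hL hw0).2.2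
      _ ≤ (1 + 2 / δ) / (2 * π ^ 2) * (1 + w ^ 2)⁻¹ := by
          rw [← div_eq_mul_inv, div_div, div_le_div_iff_of_pos_left (by positivity) (by positivity) (by positivity)]
          have : 1 ≤ w ^ 2 := by rw [← sq_abs]; exact one_le_pow₀ hw1.le
          nlinarith
      _ ≤ K * (1 + w ^ 2)⁻¹ := mul_le_mul_of_nonneg_right (le_max_right _ _) (by positivity)

/-! ### The `L¹` norm of `𝓕 H` -/

/-- The (even) majorant of `‖𝓕 H‖` used for the `L¹` bound. [folklore] -/
def fourierMajorant (T δ w : ℝ) : ℝ :=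
  min T (min (1 / (π * |w|)) (min (1 / (4 * π ^ 2 * w ^ 2) + 1 / (2 * π * |w|)) ((1 + 2 / δ) / (4 * π ^ 2 * w ^ 2))))

/-- The majorant is even. [folklore] -/
theorem fourierMajorant_abs (T δ w : ℝ) : fourierMajorant T δ |w| = fourierMajorant T δ w := by
  simp only [fourierMajorant, abs_abs, sq_abs]

/-- `‖𝓕 H(w)‖ ≤ M(w)` for `w ≠ 0`. [folklore] -/
theorem norm_fourier_trapzC_le_majorant (hδ : 0 < δ) (hL : 0 ≤ L) {w : ℝ} (hw : w ≠ 0) :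
    ‖𝓕 (trapzC L δ) w‖ ≤ fourierMajorant (1 + L + δ / 2) δ w := by
  obtain ⟨h1, h2, h3⟩ := norm_fourier_trapzC_le_three hδ hL hw
  exact le_min (norm_fourier_trapzC_le_area hδ hL w) (le_min h1 (le_min h2 h3))

/-- `0 ≤ M`. [folklore] -/
theorem fourierMajorant_nonneg {T : ℝ} (hT : 0 ≤ T) (hδ : 0 < δ) (w : ℝ) : 0 ≤ fourierMajorant T δ w := by
  unfold fourierMajorant
  refine le_min hT (le_min (by positivity) (le_min (by positivity) (by positivity)))

/-- `M` is measurable. [folklore] -/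
theorem measurable_fourierMajorant (T δ : ℝ) : Measurable (fourierMajorant T δ) := by
  unfold fourierMajorant
  refine measurable_const.min (Measurable.min ?_ (Measurable.min ?_ ?_)) <;> fun_prop

/-- `M` is integrable (`M ≤ T` and `M ≤ (1 + 2/δ)/(4π² w²)`). [folklore] -/
theorem integrable_fourierMajorant {T : ℝ} (hT : 0 ≤ T) (hδ : 0 < δ) : Integrable (fourierMajorant T δ) := by
  set K := max (2 * T) ((1 + 2 / δ) / (2 * π ^ 2)) with hK
  refine Integrable.mono' ((integrable_inv_one_add_sq).const_mul K)
    (measurable_fourierMajorant T δ).aestronglyMeasurable (Filter.Eventually.of_forall fun w => ?_)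
  have hπ := pi_pos
  rw [Real.norm_eq_abs, abs_of_nonneg (fourierMajorant_nonneg hT hδ w)]
  rcases le_or_gt |w| 1 with hw1 | hw1
  · calc fourierMajorant T δ w ≤ T := min_le_left _ _
      _ ≤ 2 * T * (1 + w ^ 2)⁻¹ := by
          rw [← div_eq_mul_inv, le_div_iff₀ (by positivity)]
          have : w ^ 2 ≤ 1 := by rw [← sq_abs]; exact pow_le_one₀ (abs_nonneg w) hw1
          nlinarith
      _ ≤ K * (1 + w ^ 2)⁻¹ := mul_le_mul_of_nonneg_right (le_max_left _ _) (by positivity)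
  · have hw0 : w ≠ 0 := fun h => by rw [h, abs_zero] at hw1; linarith
    calc fourierMajorant T δ w ≤ (1 + 2 / δ) / (4 * π ^ 2 * w ^ 2) :=
          (min_le_right _ _).trans ((min_le_right _ _).trans (min_le_right _ _))
      _ ≤ (1 + 2 / δ) / (2 * π ^ 2) * (1 + w ^ 2)⁻¹ := by
          rw [← div_eq_mul_inv, div_div, div_le_div_iff_of_pos_left (by positivity) (by positivity) (by positivity)]
          have : 1 ≤ w ^ 2 := by rw [← sq_abs]; exact one_le_pow₀ hw1.le
          nlinarith
      _ ≤ K * (1 + w ^ 2)⁻¹ := mul_le_mul_of_nonneg_right (le_max_right _ _) (by positivity)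

/-- `∫ ‖𝓕 H‖ ≤ 2 ∫_{w > 0} M(w) dw`. [folklore] -/
theorem integral_norm_fourier_trapzC_le (hδ : 0 < δ) (hL : 0 ≤ L) :
    ∫ w, ‖𝓕 (trapzC L δ) w‖ ≤ 2 * ∫ w in Ioi (0 : ℝ), fourierMajorant (1 + L + δ / 2) δ w := by
  have hT : 0 ≤ 1 + L + δ / 2 := by linarith
  rw [← integral_comp_abs]
  simp_rw [fourierMajorant_abs]
  refine integral_mono_ae (integrable_fourier_trapzC hδ hL).norm (integrable_fourierMajorant hT hδ) ?_
  have : ∀ᵐ w : ℝ ∂volume, w ≠ 0 := by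
    rw [ae_iff]; simp
  filter_upwards [this] with w hw
  exact norm_fourier_trapzC_le_majorant hδ hL hw

/-- `∫_a^b dw/(πw) = (log b - log a)/π` for `0 < a ≤ b`. [folklore] -/
theorem integral_inv_pi_mul {a b : ℝ} (ha : 0 < a) (hab : a ≤ b) :
    ∫ w in a..b, 1 / (π * w) = (Real.log b - Real.log a) / π := by
  have hπ := pi_pos
  rw [integral_eq_sub_of_hasDerivAt (f := fun w => Real.log w / π) (fun w hw => ?_)]
  · ring
  · refine ContinuousOn.intervalIntegrable fun w hw => ?_
    rw [uIcc_of_le hab] at hw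
    have : w ≠ 0 := by linarith [hw.1]
    exact (continuousAt_const.div (continuousAt_const.mul continuousAt_id) (mul_ne_zero pi_ne_zero this)).continuousWithinAt
  · rw [uIcc_of_le hab] at hw
    have hw0 : w ≠ 0 := by linarith [hw.1]
    exact ((Real.hasDerivAt_log hw0).div_const π).congr_deriv (by field_simp)

/-- `∫_a^b (1/(4π²w²) + 1/(2πw)) dw = (1/a - 1/b)/(4π²) + (log b - log a)/(2π)` for `0 < a ≤ b`. [folklore] -/
theorem integral_piece3 {a b : ℝ} (ha : 0 < a) (hab : a ≤ b) :
    ∫ w in a..b, (1 / (4 * π ^ 2 * w ^ 2) + 1 / (2 * π * w)) =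
      (1 / a - 1 / b) / (4 * π ^ 2) + (Real.log b - Real.log a) / (2 * π) := by
  have hπ := pi_pos
  rw [integral_eq_sub_of_hasDerivAt (f := fun w => -1 / (4 * π ^ 2 * w) + Real.log w / (2 * π)) (fun w hw => ?_)]
  · have hb : b ≠ 0 := by linarith
    field_simp
    ring
  · refine ContinuousOn.intervalIntegrable fun w hw => ?_
    rw [uIcc_of_le hab] at hw
    have : w ≠ 0 := by linarith [hw.1]
    exact ContinuousAt.continuousWithinAt (by fun_prop (disch := positivity))
  · rw [uIcc_of_le hab] at hw
    have hw0 : w ≠ 0 := by linarith [hw.1]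
    have h1 : HasDerivAt (fun w : ℝ => -1 / (4 * π ^ 2 * w)) (1 / (4 * π ^ 2 * w ^ 2)) w := by
      have := ((hasDerivAt_inv hw0).const_mul (-1 / (4 * π ^ 2)))
      refine (this.congr_of_eventuallyEq ?_).congr_deriv (by field_simp)
      exact Filter.Eventually.of_forall fun u => by simp only; ring
    exact (h1.add ((Real.hasDerivAt_log hw0).div_const (2 * π))).congr_deriv (by field_simp)

/-- The tail: `K/w²` is integrable on `(a, ∞)` with integral `K/a`, `a > 0`, `K ≥ 0`. [folklore] -/
theorem integral_Ioi_const_div_sq {a K : ℝ} (ha : 0 < a) (hK : 0 ≤ K) :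
    IntegrableOn (fun w : ℝ => K / w ^ 2) (Ioi a) ∧ ∫ w in Ioi a, K / w ^ 2 = K / a := by
  have hderiv : ∀ w ∈ Ioi a, HasDerivAt (fun w : ℝ => -K / w) (K / w ^ 2) w := by
    intro w hw
    have hw0 : w ≠ 0 := by rw [mem_Ioi] at hw; linarith
    have := (hasDerivAt_inv hw0).const_mul (-K)
    refine (this.congr_of_eventuallyEq ?_).congr_deriv (by field_simp)
    exact Filter.Eventually.of_forall fun u => by simp only; ring
  have hcont : ContinuousWithinAt (fun w : ℝ => -K / w) (Ici a) a :=
    ContinuousAt.continuousWithinAt (by fun_prop (disch := exact ha.ne'))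
  have hlim : Filter.Tendsto (fun w : ℝ => -K / w) Filter.atTop (nhds 0) := by
    have := (tendsto_const_nhds (x := -K)).div_atTop Filter.tendsto_id
    simpa using this
  have hnn : ∀ w ∈ Ioi a, 0 ≤ K / w ^ 2 := fun w _ => by positivity
  refine ⟨integrableOn_Ioi_deriv_of_nonneg hcont hderiv hnn hlim, ?_⟩
  rw [integral_Ioi_of_hasDerivAt_of_tendsto hcont hderiv (integrableOn_Ioi_deriv_of_nonneg hcont hderiv hnn hlim) hlim]
  field_simp
  ring

/-- **`∫_{w>0} M(w) dw ≤ 3/(2π) + (log T)/π + log(2/δ)/(2π)`**, `T = 1 + L + δ/2`, for `0 < δ ≤ 2`, `0 ≤ L`.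
[folklore] -/
theorem integral_fourierMajorant_le (hδ : 0 < δ) (hδ2 : δ ≤ 2) (hL : 0 ≤ L) :
    ∫ w in Ioi (0 : ℝ), fourierMajorant (1 + L + δ / 2) δ w ≤
      3 / (2 * π) + Real.log (1 + L + δ / 2) / π + Real.log (2 / δ) / (2 * π) := by
  have hπ := pi_pos
  have hπ3 := pi_gt_three
  set T := 1 + L + δ / 2 with hT
  have hT1 : 1 ≤ T := by rw [hT]; linarith
  have hT0 : 0 < T := by linarith
  set M := fourierMajorant T δ with hM
  set A := 1 / (2 * π * T) with hA
  set W₂ := 1 / (2 * π) with hW₂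
  set W₃ := 1 / (π * δ) with hW₃
  have hA0 : 0 < A := by positivity
  have hAW : A ≤ W₂ := by
    rw [hA, hW₂]; exact one_div_le_one_div_of_le (by positivity) (by nlinarith)
  have hW23 : W₂ ≤ W₃ := by
    rw [hW₂, hW₃]; exact one_div_le_one_div_of_le (by positivity) (by nlinarith)
  have hW30 : 0 < W₃ := by positivity
  have hMint : Integrable M := integrable_fourierMajorant hT0.le hδ
  -- split the half-line
  have hsplit : ∫ w in Ioi (0 : ℝ), M w = (∫ w in (0 : ℝ)..W₃, M w) + ∫ w in Ioi W₃, M w := by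
    rw [← Ioc_union_Ioi_eq_Ioi hW30.le, setIntegral_union (Ioc_disjoint_Ioi le_rfl) measurableSet_Ioi
      hMint.integrableOn hMint.integrableOn, intervalIntegral.integral_of_le hW30.le]
  rw [hsplit, ← integral_add_adjacent_intervals (hMint.intervalIntegrable (a := 0) (b := W₂))
    (hMint.intervalIntegrable (a := W₂) (b := W₃)),
    ← integral_add_adjacent_intervals (hMint.intervalIntegrable (a := 0) (b := A))
    (hMint.intervalIntegrable (a := A) (b := W₂))]
  -- piece 1: `[0, A]`, `M ≤ T`
  have P1 : ∫ w in (0 : ℝ)..A, M w ≤ 1 / (2 * π) := by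
    calc ∫ w in (0 : ℝ)..A, M w ≤ ∫ w in (0 : ℝ)..A, T :=
          integral_mono_on hA0.le (hMint.intervalIntegrable) (by simp) fun w _ => min_le_left _ _
      _ = 1 / (2 * π) := by rw [intervalIntegral.integral_const, smul_eq_mul, hA]; field_simp; ring
  -- piece 2: `[A, W₂]`, `M ≤ 1/(πw)`
  have P2 : ∫ w in A..W₂, M w ≤ Real.log T / π := by
    calc ∫ w in A..W₂, M w ≤ ∫ w in A..W₂, 1 / (π * w) := by
          refine integral_mono_on hAW (hMint.intervalIntegrable) ?_ fun w hw => ?_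
          · refine ContinuousOn.intervalIntegrable fun w hw => ?_
            rw [uIcc_of_le hAW] at hw
            have : w ≠ 0 := by linarith [hw.1]
            exact ContinuousAt.continuousWithinAt (by fun_prop (disch := positivity))
          · have hw0 : 0 < w := by linarith [hw.1]
            calc M w ≤ 1 / (π * |w|) := (min_le_right _ _).trans (min_le_left _ _)
              _ = 1 / (π * w) := by rw [abs_of_pos hw0]
      _ = (Real.log W₂ - Real.log A) / π := integral_inv_pi_mul hA0 hAW
      _ = Real.log T / π := by
          congr 1
          rw [← Real.log_div (by positivity) (by positivity), hW₂, hA]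
          congr 1; field_simp
  -- piece 3: `[W₂, W₃]`, `M ≤ 1/(4π²w²) + 1/(2πw)`
  have P3 : ∫ w in W₂..W₃, M w ≤ (2 - δ) / (4 * π) + Real.log (2 / δ) / (2 * π) := by
    calc ∫ w in W₂..W₃, M w ≤ ∫ w in W₂..W₃, (1 / (4 * π ^ 2 * w ^ 2) + 1 / (2 * π * w)) := by
          refine integral_mono_on hW23 (hMint.intervalIntegrable) ?_ fun w hw => ?_
          · refine ContinuousOn.intervalIntegrable fun w hw => ?_
            rw [uIcc_of_le hW23] at hw
            have : w ≠ 0 := by have := hw.1; rw [hW₂] at this; linarith [this, (by positivity : 0 < 1 / (2 * π))]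
            exact ContinuousAt.continuousWithinAt (by fun_prop (disch := positivity))
          · have hw0 : 0 < w := by have := hw.1; rw [hW₂] at this; linarith [this, (by positivity : 0 < 1 / (2 * π))]
            calc M w ≤ 1 / (4 * π ^ 2 * w ^ 2) + 1 / (2 * π * |w|) :=
                  (min_le_right _ _).trans ((min_le_right _ _).trans (min_le_left _ _))
              _ = _ := by rw [abs_of_pos hw0]
      _ = (1 / W₂ - 1 / W₃) / (4 * π ^ 2) + (Real.log W₃ - Real.log W₂) / (2 * π) :=
          integral_piece3 (by positivity) hW23
      _ = (2 - δ) / (4 * π) + Real.log (2 / δ) / (2 * π) := by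
          congr 1
          · rw [hW₂, hW₃]; field_simp
          · rw [← Real.log_div (by positivity) (by positivity), hW₂, hW₃]
            congr 2; field_simp
  -- piece 4: the tail, `M ≤ (1 + 2/δ)/(4π² w²)`
  have P4 : ∫ w in Ioi W₃, M w ≤ (δ + 2) / (4 * π) := by
    obtain ⟨hint, hval⟩ := integral_Ioi_const_div_sq (K := (1 + 2 / δ) / (4 * π ^ 2)) hW30 (by positivity)
    calc ∫ w in Ioi W₃, M w ≤ ∫ w in Ioi W₃, (1 + 2 / δ) / (4 * π ^ 2) / w ^ 2 := by
          refine setIntegral_mono_on hMint.integrableOn hint measurableSet_Ioi fun w _ => ?_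
          calc M w ≤ (1 + 2 / δ) / (4 * π ^ 2 * w ^ 2) :=
                (min_le_right _ _).trans ((min_le_right _ _).trans (min_le_right _ _))
            _ = _ := by rw [div_div]
      _ = (1 + 2 / δ) / (4 * π ^ 2) / W₃ := hval
      _ = (δ + 2) / (4 * π) := by rw [hW₃]; field_simp
  calc (∫ w in (0 : ℝ)..A, M w) + (∫ w in A..W₂, M w) + (∫ w in W₂..W₃, M w) + ∫ w in Ioi W₃, M w
      ≤ 1 / (2 * π) + Real.log T / π + ((2 - δ) / (4 * π) + Real.log (2 / δ) / (2 * π)) + (δ + 2) / (4 * π) := by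
        gcongr
    _ = 3 / (2 * π) + Real.log T / π + Real.log (2 / δ) / (2 * π) := by field_simp; ring

/-! ### Fourier inversion: `∫ 𝓕H(w) e^{2πiwy} dw = H(y)` -/

/-- Unfolding `𝓕⁻` on `ℝ`. [folklore] -/
theorem fourierInv_real_eq (f : ℝ → ℂ) (y : ℝ) :
    𝓕⁻ f y = ∫ w : ℝ, cexp (2 * π * I * (w : ℂ) * (y : ℂ)) * f w := by
  rw [Real.fourierInv_eq']
  refine integral_congr_ae (Filter.Eventually.of_forall fun w => ?_)
  simp only [smul_eq_mul, RCLike.inner_apply, conj_trivial]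
  congr 1
  push_cast
  ring_nf

/-- **Fourier inversion for the trapezoid**: `∫ e^{2πiwy} 𝓕H(w) dw = H(y)` for every `y`.
[folklore] -/
theorem integral_cexp_mul_fourier_trapzC (hδ : 0 < δ) (hL : 0 ≤ L) (y : ℝ) :
    ∫ w : ℝ, cexp (2 * π * I * (w : ℂ) * (y : ℂ)) * 𝓕 (trapzC L δ) w = trapzC L δ y := by
  have h := Continuous.fourierInv_fourier_eq (continuous_trapzC L δ) (integrable_trapzC hδ L)
    (integrable_fourier_trapzC hδ hL)
  rw [← fourierInv_real_eq, h]

/-! ### The numerical constant: `∫ ‖𝓕 H‖ < log 6x` -/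

/-- `log 3 > 1.0985` (eight terms of the series for `log(1 - 1/3) = log 2 - log 3`; cf. the identical
computation `Literature.Computability.AlgebraicComplexity.log_three_gt`, not imported here to keep the
import graph of the sieve files light). [folklore] -/
theorem log_three_gt' : (1.0985 : ℝ) < Real.log 3 := by
  have h := Real.abs_log_sub_add_sum_range_le (x := (1 / 3 : ℝ)) (by rw [abs_of_pos (by norm_num)]; norm_num) 8
  rw [abs_of_pos (by norm_num : (0 : ℝ) < 1 / 3)] at h
  have hs : ∑ i ∈ Finset.range 8, (1 / 3 : ℝ) ^ (i + 1) / (i + 1) = 744857 / 1837080 := by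
    simp only [Finset.sum_range_succ, Finset.sum_range_zero]
    norm_num
  rw [hs, show (1 : ℝ) - 1 / 3 = 2 / 3 by norm_num, Real.log_div (by norm_num) (by norm_num)] at h
  have h2 := Real.log_two_gt_d9
  have h' := (abs_le.1 h).2
  norm_num at h'
  linarith

/-- The parameters: for `n ≥ 1`, `L = log n ≥ 0` and `0 < δ = log((n+1)/n) ≤ log 2`, `δ ≥ 1/(n+1)`,
`L + δ = log(n+1)`. [folklore] -/
theorem params_spec {n : ℕ} (hn : 1 ≤ n) :
    0 ≤ Real.log n ∧ 0 < Real.log ((n + 1) / n) ∧ Real.log ((n + 1) / n) ≤ Real.log 2 ∧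
      1 / (n + 1 : ℝ) ≤ Real.log ((n + 1) / n) ∧ Real.log n + Real.log ((n + 1) / n) = Real.log (n + 1) := by
  have hn0 : (0 : ℝ) < n := by exact_mod_cast hn
  have hn1 : (1 : ℝ) ≤ n := by exact_mod_cast hn
  refine ⟨Real.log_nonneg hn1, Real.log_pos (by rw [lt_div_iff₀ hn0]; linarith), ?_, ?_, ?_⟩
  · exact Real.log_le_log (by positivity) (by rw [div_le_iff₀ hn0]; linarith)
  · have := Real.one_sub_inv_le_log_of_pos (x := ((n : ℝ) + 1) / n) (by positivity)
    rw [inv_div] at this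
    convert this using 1
    field_simp; ring
  · rw [← Real.log_mul hn0.ne' (by positivity)]
    congr 1; field_simp

/-- **`∫ ‖𝓕 H‖ < log(6n)`** for the parameters `L = log n`, `δ = log((n+1)/n)`, `n ≥ 1`. [folklore] -/
theorem integral_norm_fourier_trapzC_lt {n : ℕ} (hn : 1 ≤ n) :
    ∫ w, ‖𝓕 (trapzC (Real.log n) (Real.log ((n + 1) / n))) w‖ < Real.log (6 * n) := by
  obtain ⟨hL, hδ, hδ2, hδl, -⟩ := params_spec hn
  set L := Real.log n with hLdef
  set δ := Real.log ((n + 1 : ℝ) / n) with hδdef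
  have hn0 : (0 : ℝ) < n := by exact_mod_cast hn
  have hπ := pi_gt_d2
  have hπ0 := pi_pos
  have hl2u := Real.log_two_lt_d9
  have hl2l := Real.log_two_gt_d9
  have hl3 := log_three_gt'
  have hδ07 : δ ≤ 0.6932 := by linarith
  -- the bound of the previous section
  have h1 := integral_norm_fourier_trapzC_le hδ hL
  have h2 := integral_fourierMajorant_le hδ (by linarith) hL
  set T := 1 + L + δ / 2 with hT
  -- `log T ≤ 0.3466 + log n`
  have hT1 : 1 ≤ T := by rw [hT]; linarith
  have hlogT : Real.log T ≤ 0.3466 + L := by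
    have hTle : T ≤ 1.3466 * (1 + L) := by rw [hT]; nlinarith
    have h1L : 0 < 1 + L := by linarith
    calc Real.log T ≤ Real.log (1.3466 * (1 + L)) := Real.log_le_log (by linarith) hTle
      _ = Real.log 1.3466 + Real.log (1 + L) := Real.log_mul (by norm_num) h1L.ne'
      _ ≤ (1.3466 - 1) + L := by
          refine add_le_add (Real.log_le_sub_one_of_pos (by norm_num)) ?_
          -- `log (1 + log n) ≤ log n` since `1 + log n ≤ n`
          have hle : 1 + L ≤ n := by
            have := Real.add_one_le_exp L
            rw [hLdef, Real.exp_log hn0] at this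
            rw [hLdef]; linarith
          calc Real.log (1 + L) ≤ Real.log n := Real.log_le_log h1L hle
            _ = L := rfl
      _ = 0.3466 + L := by ring
  -- `log (2/δ) ≤ 2 log 2 + log n`
  have hlogδ : Real.log (2 / δ) ≤ 2 * Real.log 2 + L := by
    have h4 : 2 / δ ≤ 4 * n := by
      rw [div_le_iff₀ hδ]
      have : (1 : ℝ) ≤ n := by exact_mod_cast hn
      have h5 : 1 / ((n : ℝ) + 1) * (4 * n) ≤ δ * (4 * n) := mul_le_mul_of_nonneg_right hδl (by positivity)
      have h6 : 2 ≤ 1 / ((n : ℝ) + 1) * (4 * n) := by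
        rw [div_mul_eq_mul_div, le_div_iff₀ (by positivity)]; linarith
      linarith
    calc Real.log (2 / δ) ≤ Real.log (4 * n) := Real.log_le_log (by positivity) h4
      _ = Real.log 4 + L := by rw [Real.log_mul (by norm_num) hn0.ne']
      _ = 2 * Real.log 2 + L := by rw [show (4 : ℝ) = 2 ^ 2 by norm_num, Real.log_pow]; push_cast; ring
  -- conclude
  have hlog6 : Real.log (6 * n) = Real.log 2 + Real.log 3 + L := by
    rw [Real.log_mul (by norm_num) hn0.ne', show (6 : ℝ) = 2 * 3 by norm_num, Real.log_mul (by norm_num) (by norm_num)]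
  rw [hlog6]
  refine (h1.trans (mul_le_mul_of_nonneg_left h2 (by norm_num))).trans_lt ?_
  -- clear denominators: multiply by `π`
  have key : 3 + 2 * Real.log T + Real.log (2 / δ) < π * (Real.log 2 + Real.log 3 + L) := by
    have hA : π * L ≥ 3.14 * L := mul_le_mul_of_nonneg_right hπ.le hL
    have hB : π * (Real.log 2 + Real.log 3) ≥ 3.14 * (Real.log 2 + Real.log 3) :=
      mul_le_mul_of_nonneg_right hπ.le (by linarith)
    nlinarith
  have e : 2 * (3 / (2 * π) + Real.log T / π + Real.log (2 / δ) / (2 * π)) =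
      (3 + 2 * Real.log T + Real.log (2 / δ)) / π := by field_simp
  rw [e, div_lt_iff₀ hπ0]
  linarith

/-! ### Lemma 26.1 -/

/-- Change of variables `t = 2πw`. [folklore] -/
theorem integral_comp_div_two_pi (G : ℝ → ℂ) : ∫ t : ℝ, G (t / (2 * π)) = (2 * π) * ∫ w, G w := by
  have h := MeasureTheory.Measure.integral_comp_mul_left G (2 * π)⁻¹
  simp only [inv_inv] at h
  rw [abs_of_pos (by positivity), Complex.real_smul] at h
  push_cast at h
  rw [← h]
  refine integral_congr_ae (Filter.Eventually.of_forall fun t => ?_)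
  simp only [div_eq_inv_mul]

/-- Change of variables `t = 2πw`, real-valued version. [folklore] -/
theorem integral_comp_div_two_pi_real (G : ℝ → ℝ) : ∫ t : ℝ, G (t / (2 * π)) = (2 * π) * ∫ w, G w := by
  have h := MeasureTheory.Measure.integral_comp_mul_left G (2 * π)⁻¹
  simp only [inv_inv] at h
  rw [abs_of_pos (by positivity), smul_eq_mul] at h
  rw [← h]
  refine integral_congr_ae (Filter.Eventually.of_forall fun t => ?_)
  simp only [div_eq_inv_mul]

/-- **The separating function** `h(t) = 𝓕H(t/2π)/(2π)`, `H` the trapezoid with `L = log ⌊x⌋`,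
`δ = log(1 + 1/⌊x⌋)`. [cite: FriedlanderIwaniecAnnals1998, Lemma 26.1] -/
def sepFun (x : ℝ) (t : ℝ) : ℂ :=
  𝓕 (trapzC (Real.log ⌊x⌋₊) (Real.log ((⌊x⌋₊ + 1) / ⌊x⌋₊))) (t / (2 * π)) / (2 * π)

/-- **Friedlander–Iwaniec, Lemma 26.1** (Duke–Friedlander–Iwaniec, Lemma 9). For `x ≥ 1` there is a
function `h` (namely `sepFun x`) with `∫ |h(t)| dt < log 6x` such that for every positive integer `k`,
`∫ h(t) k^{it} dt = 1` if `k ≤ x` and `= 0` otherwise (`k^{it} = e^{it log k}`).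
[cite: FriedlanderIwaniecAnnals1998, Lemma 26.1] -/
theorem lemma261 {x : ℝ} (hx : 1 ≤ x) :
    Integrable (sepFun x) ∧ (∫ t, ‖sepFun x t‖) < Real.log (6 * x) ∧
      ∀ k : ℕ, 1 ≤ k → ∫ t : ℝ, sepFun x t * cexp (I * t * Real.log k) = if (k : ℝ) ≤ x then 1 else 0 := by
  set n := ⌊x⌋₊ with hndef
  have hn : 1 ≤ n := Nat.le_floor (by exact_mod_cast hx)
  obtain ⟨hL, hδ, hδ2, -, hLδ⟩ := params_spec hn
  set L := Real.log n with hLdef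
  set δ := Real.log ((n + 1 : ℝ) / n) with hδdef
  have hn0 : (0 : ℝ) < n := by exact_mod_cast hn
  have hπ0 := pi_pos
  set F := 𝓕 (trapzC L δ) with hF
  have hFint : Integrable F := integrable_fourier_trapzC hδ hL
  have hsep : ∀ t, sepFun x t = F (t / (2 * π)) / (2 * π) := fun t => rfl
  -- integrability of `h`
  have hint : Integrable (sepFun x) := by
    have h1 : Integrable (fun t : ℝ => F ((2 * π)⁻¹ * t)) := hFint.comp_mul_left' (by positivity)
    have h2 := h1.div_const ((2 * π : ℝ) : ℂ)
    refine h2.congr (Filter.Eventually.of_forall fun t => ?_)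
    rw [hsep]; push_cast; rw [div_eq_inv_mul t]
  refine ⟨hint, ?_, fun k hk => ?_⟩
  · -- the `L¹` norm
    have e1 : ∫ t, ‖sepFun x t‖ = ∫ w, ‖F w‖ := by
      have h2π : ‖((2 : ℂ) * π)‖ = 2 * π := by
        rw [show ((2 : ℂ) * π) = ((2 * π : ℝ) : ℂ) by push_cast; ring, Complex.norm_real, Real.norm_eq_abs,
          abs_of_pos (by positivity)]
      calc ∫ t, ‖sepFun x t‖ = ∫ t, ‖F (t / (2 * π))‖ / (2 * π) := by
            refine integral_congr_ae (Filter.Eventually.of_forall fun t => ?_)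
            show ‖sepFun x t‖ = ‖F (t / (2 * π))‖ / (2 * π)
            rw [hsep, norm_div, h2π]
        _ = (2 * π) * ∫ w, ‖F w‖ / (2 * π) := integral_comp_div_two_pi_real (fun w => ‖F w‖ / (2 * π))
        _ = ∫ w, ‖F w‖ := by rw [MeasureTheory.integral_div, mul_div_cancel₀ _ (by positivity)]
    rw [e1]
    calc ∫ w, ‖F w‖ < Real.log (6 * n) := integral_norm_fourier_trapzC_lt hn
      _ ≤ Real.log (6 * x) := Real.log_le_log (by positivity) (by linarith [Nat.floor_le (by linarith : (0:ℝ) ≤ x)])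
  · -- the identity
    have hk0 : (0 : ℝ) < k := by exact_mod_cast hk
    have h2π : ((2 : ℂ) * π) ≠ 0 := by exact_mod_cast (by positivity : (0:ℝ) < 2 * π).ne'
    have e1 : ∫ t : ℝ, sepFun x t * cexp (I * t * Real.log k) =
        ∫ w : ℝ, cexp (2 * π * I * (w : ℂ) * ((Real.log k : ℝ) : ℂ)) * F w := by
      calc ∫ t : ℝ, sepFun x t * cexp (I * t * Real.log k)
          = ∫ t : ℝ, cexp (2 * π * I * (((t / (2 * π) : ℝ)) : ℂ) * ((Real.log k : ℝ) : ℂ)) * F (t / (2 * π)) / (2 * π) := by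
            refine integral_congr_ae (Filter.Eventually.of_forall fun t => ?_)
            show sepFun x t * _ = _
            rw [hsep]
            have : cexp (I * t * Real.log k) = cexp (2 * π * I * ((t / (2 * π) : ℝ) : ℂ) * ((Real.log k : ℝ) : ℂ)) := by
              congr 1; push_cast; field_simp
            rw [this]; ring
        _ = (2 * π) * ∫ w : ℝ, cexp (2 * π * I * (w : ℂ) * ((Real.log k : ℝ) : ℂ)) * F w / (2 * π) :=
            integral_comp_div_two_pi (fun w => cexp (2 * π * I * (w : ℂ) * ((Real.log k : ℝ) : ℂ)) * F w / (2 * π))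
        _ = _ := by rw [MeasureTheory.integral_div, mul_div_cancel₀ _ h2π]
    rw [e1, integral_cexp_mul_fourier_trapzC hδ hL, trapzC]
    by_cases hkx : (k : ℝ) ≤ x
    · rw [if_pos hkx]
      have hkn : k ≤ n := Nat.le_floor hkx
      have : trapz L δ (Real.log k) = 1 := by
        refine trapz_of_mem_mid hδ ⟨Real.log_nonneg (by exact_mod_cast hk), ?_⟩
        exact Real.log_le_log hk0 (by exact_mod_cast hkn)
      simp [this]
    · rw [if_neg hkx]
      have hkn : n + 1 ≤ k := by
        have h1 : (n : ℝ) < k := lt_of_le_of_lt (Nat.floor_le (by linarith)) (not_le.mp hkx)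
        exact_mod_cast h1
      have : trapz L δ (Real.log k) = 0 := by
        refine trapz_of_ge hδ ?_
        rw [hLδ]
        exact Real.log_le_log (by positivity) (by exact_mod_cast hkn)
      simp [this]

end Literature.NumberTheory.Sieve.FriedlanderIwaniecPrimes
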